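import Summits.AtomisticToContinuum.HydrodynamicLimit.Theses.CollisionIsometryCLT
import Summits.AtomisticToContinuum.HydrodynamicLimit.Theses.StiffCollisionalRelaxation
import Summits.AtomisticToContinuum.HydrodynamicLimit.Theses.SpeedCapSurgery
import Summits.AtomisticToContinuum.HydrodynamicLimit.Theorems.AprioriBounds.Negative.WithoutSmallSigma
import Summits.AtomisticToContinuum.HydrodynamicLimit.Theorems.AprioriBounds.Negative.AllLambda
import Literature.Analysis.FluidPDE.HardSphereCollisionRecord
import Literature.MathematicalPhysics.KineticTheory.HardSphereEulerProofs

/-!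
# Line `stiff-localised-povzner` for the crux `AprioriBounds` (stmt-AtomisticToContinuum-9519)

Route `CollisionIsometryCLT` (rank 5); the decl is SHARED verbatim with
`StiffCollisionalRelaxation.AprioriBounds` (rank 4; the item's primary copy). The crux, read back:
`∀ nice profiles ∃ σ₀ ∀ σ ∈ (0,σ₀) ∀ Φ ∀ t > 0, (i) ∧ (ii)` with
(i) `∃ λ > 0, C : P_N{ C < ∫_{s∈[0,t]} (N+1)⁻¹ Σᵢ e^{λ|vᵢ(s)|²} ds } → 0` (time-averaged one-particle
exponential velocity moment; `P_N` = the local Gibbs law, the gas evolved deterministically) and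
(ii) `∀ admissible kernel families ∃ c₁ > 0 : P_N{∃ s ≤ t ∃ x, ρ̄ < c₁ ∨ 1 < ρ̄σ³} → 0`.

## The lever (crux idea `stiff-localised-povzner`, ideator 2; triage r1: pass / pass / pass)

STIFFNESS LOCALISES POVZNER. Along every good hard-sphere orbit the velocity telescoping identity
`Σᵢ χ(xᵢ(t))ψ(vᵢ(t)) − Σᵢ χ(xᵢ(0))ψ(vᵢ(0)) = Σ_{records in (0,t]} χ(x_fst)[ψ(v_fst⁺) − ψ(v_fst⁻)]
+ ∫₀ᵗ Σᵢ (∇χ(xᵢ)·vᵢ) ψ(vᵢ) ds` (first lemma `IdeatorTwo.VelocityTelescoping`, rc 0, localised with a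
Lipschitz window `χ`) turns the time-INTEGRATED moment hierarchy of the deterministic gas into an
identity in which the collision term carries the diverging clock `ν_N = σ²(N+1)^{1/3}` and the transport
leak carries `1/h_N` only, `h_N = (N+1)^{-1/6}` the window scale: leak / loss `≍ (h_N ν_N)^{-1} → 0`.
Hence the Bobylev–Gamba–Panferov / Alonso–Cañizo–Gamba–Mouhot (ACGM 2013, Thm 2: propagation of
ORDER-2 exponential moments for hard spheres) barrier argument can be run WINDOW BY WINDOW on the
empirical collision measure of ONE trajectory: with the exact per-record Povzner split
`|v⁺|^{2p} summed over a collision = h_p(u)·[(E₁+E₂)^p − E₁^p − E₂^p] + h_p(u)(E₁^p + E₂^p)`,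
`h_p(u) = u^p + (1−u)^p`, the loss is the window's own incoming collision moment `c_p`, the gain is
`h_p ×` the MIXED binomial moment (small on average for `p ≥ p₀`: impact spread) dominated INSIDE the
window by products `K c_k c_{p−k}/c_0` (partner domination), the leak is a short-flight conversion of
a neighbouring window's supply, and "what collisions destroy was there at time 0" (the initial
Gaussian content of the local Gibbs data, rate 2 INHERITED, never created). The statistical input is
one-sided, constant-factor, WINDOW-wise and restricted to the POPULATED index range
`p ≤ ⌊r log(N+2)⌋` (the `√log N` speed cap empties everything above and truncates every Taylor
series) — the three triage repairs: granularity (r1-1 sharpen 1, r1-3 C2: threshold form, populated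
range + cap), per-window induction with the leak as a perturbation of the loss (r1-1 sharpen 2), and
the cell-wise nonlinearity of the closing condition (r1-2 §C: closed here by the max over windows of
the count-normalised exponential collision moment, continuity in the RATE `a` from `a = 0`, so that
the relative no-concentration input H4_rel of r1-2 becomes a consequence of the order-ONE envelope
`c₁ ≤ Θ_c c₀` and two-sided Enskog-order window counts, never a hypothesis at exponential level).

## Stubs (7, registered; D-0027 §3.3 shape: sorried theorems in `Holds`, statements by name, `_of`)
1. `stub_initialWindows` — t = 0, provable now (M–L): window-wise Gaussian content of the data.
2. `stub_speedCap` — DOCKED = `SpeedCapSurgery.MaxSpeedBoundLog` (stmt-9629) VERBATIM (`Iff.rfl`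
   certificate below); producer on this board: `pythagorean-mgf-transport` (`EnvelopeGivesCap`).
3. `stub_povznerStatistics` — OPEN (the chaos input α of the board, window-wise, populated range):
   impact spread (H2, threshold form) and in-window partner domination (H3).
4. `stub_shortFlights` — OPEN (the no-channelling input β, window-wise, tilted, with a thermal
   budget): occupation ≤ Enskog conversion of supply — this is where STIFFNESS enters (`ν_N → ∞`).
5. `stub_windowEnvelope` — OPEN (the mesoscopic envelope every (i)-line carries, C3, in COLLISION
   currency: two-sided Enskog-order window counts + order-one collision temperature cap `Θ_c`).
6. `stub_localisedPovzner` — THE LEVER, deterministic given 1–5 (XL): the windowed ACGM argument ⇒ (i).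
7. `stub_chamber` — (ii), DOCKED on the landed decl `AprioriBoundsNegative.AprioriBoundsIIAt`
   (producers: `commutator-matched-bootstrap` ≈ `bootstrap-chamber-confinement`).
`AprioriBounds_of h1 … h7 : CollisionIsometryCLT.AprioriBounds` — quantifier logic, kernel-checked,
no sorry; `AprioriBounds_of_stiff` / `AprioriBounds_proof` for the item's primary copy
`StiffCollisionalRelaxation.AprioriBounds`.

## Exposure and Disproof used (`Cruxes/AprioriBounds/Disproof.lean`, cdisprove cycles 1–2, NO KILL)
* No `_false_without_<H>` theorem exists for (i). `Negative/AllLambda`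
  (`aprioriBoundsI_allLambda_false_at_equilibrium`, imported): honoured — `λ` is existential in
  `PartIAt`; the engine OUTPUTS a small rate `a⋆ ≤ a₁ < 1/(8 sup θ₀)` shrunk further by the dynamical
  constants (`Θ_c`, `K`, `γ₂`, cap `C`): "the line uses H = bounded collision temperature at
  `stub_windowEnvelope`" (Disproof §4d/§7 message (c): λ is dictated by the hottest block).
* `Negative/WithoutSmallSigma` (`aprioriBoundsII_false_without_small_sigma`, `aprioriBoundsIIAt_false`,
  `aprioriBounds_sigma0_le_one`) and `BlockDensityAveraging` (`c₁ ≤ 1`): `stub_chamber` is stated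
  over the very decl `AprioriBoundsIIAt` and keeps `∃ σ₀`, `∃ c₁`; `σ₀ := min … σ₇ … 2⁻¹` in `_of`.
* `Negative/ExpMomentTangent` (not imported: unbuilt on the farm at planning time; read in
  `Disproof.lean` §7) + `AprioriBounds_false_of_PersistentHotSpot` (negative MODULO a
  post-collapse LLN; item HELD, not refuted) and Disproof §5/§6 (SUBSTANTIVE THREAT `∀ t > 0`,
  repair C′ = `AprioriBoundsRepaired`, `t < T`): the crux is typed `∀ t > 0` and this skeleton
  concludes it BY NAME, so the dynamical stubs 2–5 and 7 are stated `∀ t > 0` with EXISTENTIAL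
  envelopes (`C`, `γ₂, K, r, p₀`, `C_R, B`, `c_f, C_f, Θ_c`, `c₁` after `t`) and inherit exactly the
  crux's own exposure (Guderley core: `Θ_c, C` cease to exist; vacuum: `c_f, c₁` cease to exist) —
  nothing more; under C′ every stub restricts verbatim (`∀ t > 0 ↦ ∀ t ∈ (0,T)`) and `_of` is
  unchanged. No `AprioriBoundsPreShock → AprioriBounds` stub is used (triage r1-3 C0).
* Negatives index (12): `EulerCharacteristics.ExpTailBudget` (stmt-14607, `e^{-cN}` currency) — no
  stub claims exponential-in-`N` probabilities; 9236/9238 (sub-population variance quantifiers) — not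
  instantiated; 11470 `LanfordEnvelope` (junk `flow` off `Φ.good` under a pathwise `∀ z`) — every
  stub here is a `localGibbsLaw`-probability (`≪ liouville`, `goodᶜ` null), none quantifies over
  orbits. Retired board item 4603 `FastParticleCollisionRate` (GLOBAL, in expectation, ALL `p`, every
  sub-interval; "false in its LOSS form for channelled survivors"): `stub_shortFlights` differs at the
  dead step — whole window `(0,t]` with the INITIAL supply paying for survivors, populated range
  only, and an additive thermal budget `B^p p!·(N+1)ϱ³t` absorbing sub-extensive channelled mass.
-/

set_option autoImplicit false

noncomputable section

open MeasureTheory Filter Set Topology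
open scoped ENNReal BigOperators Classical

namespace Summit.AtomisticToContinuum.HydrodynamicLimit.Cruxes.AprioriBounds.StiffLocalisedPovzner

open Literature.MathematicalPhysics.KineticTheory Literature.Analysis.FluidPDE

/-! ## Types (the crux's) -/

/-- Phase space of `N + 1` spheres on `𝕋³`. -/
abbrev Cfg (N : ℕ) : Type := Config (N + 1) (Fin 3) T3
/-- A hard-sphere flow of `N + 1` spheres of diameter `hsDiameter σ N = σ (N+1)^{-1/3}` on `𝕋³`. -/
abbrev Flow (σ : ℝ) (N : ℕ) : Type :=
  HardSphereFlow (Torus.geometry (Fin 3)) (hsDiameter σ N) (N + 1)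
/-- Families of flows (the crux's `Φ`). -/
abbrev Flows (σ : ℝ) : Type := (N : ℕ) → Flow σ N
/-- Collision records of `N + 1` spheres on `𝕋³` (both orderings of every collision are records). -/
abbrev Rec (N : ℕ) : Type := HardSphereCollisionRecord (Fin 3) T3 (N + 1)

/-- The crux's profile hypotheses. -/
def NiceProfiles (a₀ θ₀ : T3 → ℝ) (u₀ : T3 → V3) : Prop :=
  Continuous a₀ ∧ Continuous θ₀ ∧ Continuous u₀ ∧ (∀ x, 0 < a₀ x) ∧ (∀ x, 0 < θ₀ x)

/-! ## Scales -/

/-- The mesoscopic WINDOW scale `h_N = (N+1)^{-1/6}`: `≫` one mean free path `(N+1)^{-1/3}/σ²`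
(so flights rarely leave a window: the leak is perturbative) and `≪ 1` (so the within-window
temperature mixture factor tends to `1` on the populated levels, IdeatorTwoBarrierNotes B5). Any
exponent in `(0, 1/3)` would do. -/
def hN (N : ℕ) : ℝ := ((N : ℝ) + 1) ^ (-(1 / 6 : ℝ))

/-- The collision clock `ν_N = σ² (N+1)^{1/3}` (collisions per particle per unit macroscopic time, up
to the thermal speed: `N+1` spheres of cross-section `≍ ε_N² = σ²(N+1)^{-2/3}` in unit volume). -/
def nu (σ : ℝ) (N : ℕ) : ℝ := σ ^ 2 * ((N : ℝ) + 1) ^ ((1 : ℝ) / 3)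

/-- The POPULATED index range `p ≤ ⌊r log(N+2)⌋`: a window holds `≍ (N+1)h_N³ ν_N t = N^{5/6}σ²t`
records, of which `≍ e^{-p}·N^{5/6}` carry pair energy `≈ 2θp`; for `r < 5/6` every index in range is
in the law-of-large-numbers regime (triage r1-1 granularity test, r1-3 C2), and the `√log N` cap makes
the indices above the range irrelevant once the rate `a` is small (`a ≤ r/(e²C²)`). -/
def idx (r : ℝ) (N : ℕ) : ℕ := ⌊r * Real.log ((N : ℝ) + 2)⌋₊

/-! ## Window statistics of ONE trajectory (pathwise; meaningful on `Φ.good`, junk elsewhere — a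
`localGibbsLaw`-null set) -/

/-- Indicator weight of the open torus ball `B(x, ϱ)` (`Torus.euclidDist`). -/
def inBall (x : T3) (ϱ : ℝ) (y : T3) : ℝ := if Torus.euclidDist y x < ϱ then 1 else 0

/-- WINDOWED RECORD SUM: `Σ_{records c in (0,t], x_fst(c) ∈ B(x,ϱ)} F(c)` along the orbit of `z`
(records are assigned to windows by the position of their FIRST particle; `Φ.collisionSum` is the
tree's record sum, a genuine finite sum on `Φ.good`). -/
def wrec {σ : ℝ} {N : ℕ} (Φ : Flow σ N) (z : Cfg N) (t : ℝ) (x : T3) (ϱ : ℝ) (F : Rec N → ℝ) : ℝ :=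
  Φ.collisionSum (Ioc 0 t) (fun c => inBall x ϱ c.fstPos * F c) z

/-- `c₀`: the number of records of the window. -/
def cnt {σ : ℝ} {N : ℕ} (Φ : Flow σ N) (z : Cfg N) (t : ℝ) (x : T3) (ϱ : ℝ) : ℝ :=
  wrec Φ z t x ϱ fun _ => 1

/-- `c_p`: the window's INCOMING one-body collision moment `Σ_records |v_fst⁻|^{2p}` — the LOSS
currency of the line (what the records of the window take out of level `p`). -/
def cmom {σ : ℝ} {N : ℕ} (Φ : Flow σ N) (z : Cfg N) (t : ℝ) (x : T3) (ϱ : ℝ) (p : ℕ) : ℝ :=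
  wrec Φ z t x ϱ fun c => ‖c.preVel.1‖ ^ (2 * p)

/-- `c_{k,l}`: the window's incoming PAIR collision moment `Σ_records |v_fst⁻|^{2k} |v_snd⁻|^{2l}`. -/
def cross {σ : ℝ} {N : ℕ} (Φ : Flow σ N) (z : Cfg N) (t : ℝ) (x : T3) (ϱ : ℝ) (k l : ℕ) : ℝ :=
  wrec Φ z t x ϱ fun c => ‖c.preVel.1‖ ^ (2 * k) * ‖c.preVel.2‖ ^ (2 * l)

/-- `g_p`: the window's OUTGOING one-body collision moment `Σ_records |v_fst⁺|^{2p}` — the GAIN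
currency (summed over the two records of one collision it is `h_p(u)(E₁+E₂)^p`,
`h_p(u) = u^p + (1-u)^p`, `u` the outgoing energy fraction). -/
def gainOne {σ : ℝ} {N : ℕ} (Φ : Flow σ N) (z : Cfg N) (t : ℝ) (x : T3) (ϱ : ℝ) (p : ℕ) : ℝ :=
  wrec Φ z t x ϱ fun c => ‖c.postVel.1‖ ^ (2 * p)

/-- `M_p`: the window's MIXED binomial moment `Σ_records [(E₁+E₂)^p − E₁^p − E₂^p]`
(`= Σ_records Σ_{k=1}^{p-1} (p choose k) E₁^k E₂^{p-k} ≥ 0`; the only place where the Povzner gain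
lives after the exact split). -/
def mixed {σ : ℝ} {N : ℕ} (Φ : Flow σ N) (z : Cfg N) (t : ℝ) (x : T3) (ϱ : ℝ) (p : ℕ) : ℝ :=
  wrec Φ z t x ϱ fun c =>
    (‖c.preVel.1‖ ^ 2 + ‖c.preVel.2‖ ^ 2) ^ p - ‖c.preVel.1‖ ^ (2 * p) - ‖c.preVel.2‖ ^ (2 * p)

/-- TILTED OCCUPATION of the window at level `p`: `∫₀ᵗ Σ_{i : xᵢ(s) ∈ B(x,ϱ)} |vᵢ(s)|^{2p}(1 + |vᵢ(s)|) ds`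
(the Enskog tilt `1 + |v|`: a sphere of speed `|v|` should fly only `≍ 1/(ν_N(1+|v|))` before its
next collision; the tilt is also exactly the transport-leak weight `|∇χ·v| ψ_p(v)` of the localised
telescoping identity). -/
def occ {σ : ℝ} {N : ℕ} (Φ : Flow σ N) (z : Cfg N) (t : ℝ) (x : T3) (ϱ : ℝ) (p : ℕ) : ℝ :=
  ∫ s in Icc 0 t, ∑ i : Fin (N + 1),
    inBall x ϱ (Φ.flow s z i).1 * (‖(Φ.flow s z i).2‖ ^ (2 * p) * (1 + ‖(Φ.flow s z i).2‖))

/-- INITIAL SUPPLY of the window at level `p`: `Σ_{i : xᵢ(0) ∈ B(x,ϱ)} |vᵢ(0)|^{2p}` (the flights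
present at time `0` — the "survivors" — are paid for here, statically). -/
def supplyInit {N : ℕ} (z : Cfg N) (x : T3) (ϱ : ℝ) (p : ℕ) : ℝ :=
  ∑ i : Fin (N + 1), inBall x ϱ (z i).1 * ‖(z i).2‖ ^ (2 * p)

/-- INITIAL WINDOW GAUSSIAN CONTENT at rate `a`: `(N+1)⁻¹ Σ_{i : xᵢ(0) ∈ B(x,ϱ)} e^{a|vᵢ(0)|²}`
(`≍ ϱ³` for a local Gibbs datum and `a < 1/(2 sup θ₀)`). -/
def initWin {N : ℕ} (z : Cfg N) (x : T3) (ϱ : ℝ) (a : ℝ) : ℝ :=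
  ((N : ℝ) + 1)⁻¹ * ∑ i : Fin (N + 1), inBall x ϱ (z i).1 * Real.exp (a * ‖(z i).2‖ ^ 2)

/-! ## The statements AT `(σ, profiles, Φ, t)` (all probabilities under the transported local Gibbs
law `localGibbsLaw σ a₀ u₀ θ₀ N (Φ N)`, exactly the crux's `P_N`; every hypothesis is an EVENT whose
complement has probability `→ 0`, with its constants existential AFTER `t` — the crux's own exposure) -/

/-- **Initial window content (t = 0).** `∃ a₁ > 0 ∀ a ∈ (0,a₁] ∃ C₀`: with probability `→ 1`, EVERY
window `B(x,ϱ)` with `ϱ ≥ h_N` (the whole torus included: `ϱ = 1`) has Gaussian content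
`initWin ≤ C₀ ϱ³` at rate `a`. -/
def InitWinAt (σ : ℝ) (a₀ θ₀ : T3 → ℝ) (u₀ : T3 → V3) (Φ : Flows σ) : Prop :=
  ∃ a₁ : ℝ, 0 < a₁ ∧ ∀ a : ℝ, 0 < a → a ≤ a₁ → ∃ C₀ : ℝ,
    Tendsto (fun N : ℕ => localGibbsLaw σ a₀ u₀ θ₀ N (Φ N)
      {z | ¬ ∀ (x : T3) (ϱ : ℝ), hN N ≤ ϱ → initWin z x ϱ a ≤ C₀ * ϱ ^ 3})
      atTop (𝓝 0)

/-- **The `√log N` speed cap at `(σ, Φ, t)`** — VERBATIM the body of `SpeedCapSurgery.MaxSpeedBoundLog`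
(stmt-9629) after its profile/`σ`/`t`/`Φ` prefix: for some `C`, the probability that some sphere is
faster than `C√log(N+2)` at some time in `[0,t]` tends to `0`. -/
def CapAt (σ : ℝ) (a₀ θ₀ : T3 → ℝ) (u₀ : T3 → V3) (Φ : Flows σ) (t : ℝ) : Prop :=
  ∃ C : ℝ, Tendsto (fun N : ℕ => localGibbsLaw σ a₀ u₀ θ₀ N (Φ N)
    {z | ∃ r ∈ Icc 0 t, ∃ i, C * Real.sqrt (Real.log ((N : ℝ) + 2)) < ‖((Φ N).flow r z i).2‖})
    atTop (𝓝 0)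

/-- **Povzner statistics of the windows (H2 ∧ H3, populated range, populated windows).** There are
`γ₂ < 1` (loss margin), `K > 0` (partner-domination constant) and `r > 0` (populated range) such
that for every population threshold `c_g > 0` and every `γ⋆ > 0` there is an index `p₀` with: with
probability `→ 1`, for EVERY window `B(x,ϱ)`, `h_N ≤ ϱ ≤ 8h_N`, holding at least
`c_g (N+1)ϱ³ν_N t` records (the engine takes `c_g := c_f` of `WindowEnvelopeAt`, so the guard is
discharged there; it only exempts collisionally dead windows, where no LLN can hold),
(H2, IMPACT SPREAD, threshold form) for `2 ≤ p ≤ ⌊r log(N+2)⌋`: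
`g_p ≤ (γ/2)·M_p + γ₂·c_p` with `γ = γ⋆` if `p ≥ p₀` and `γ = 1` otherwise — summed over a collision,
`h_p(u)·[(E₁+E₂)^p − E₁^p − E₂^p] + h_p(u)(E₁^p+E₂^p)` with the `M_p`-weighted mean of `h_p` at most `γ`
and the own-weighted mean at most `γ₂` (no pile-up of energetic collisions at grazing / head-on
geometry `u ∈ {0,1}`; under a bounded impact density `E h_p ≈ 2/(p+1) → 0`);
(H3, PARTNER DOMINATION inside the window) for `k, l ≥ 1`, `k + l ≤ ⌊r log(N+2)⌋`:
`c_{k,l}·c₀ ≤ K·c_k·c_l` — energetic spheres meet the window's typical partners, not each other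
(one-sided; in collision currency the flux factor `|(v−w)·ω|` sits once in `c_{k,l}` and once in EACH
of `c_k, c_l`, so chaos gives `K ≈ 4`). -/
def PovznerStatsAt (σ : ℝ) (a₀ θ₀ : T3 → ℝ) (u₀ : T3 → V3) (Φ : Flows σ) (t : ℝ) : Prop :=
  ∃ γ₂ K r : ℝ, γ₂ < 1 ∧ 0 < K ∧ 0 < r ∧ ∀ cg : ℝ, 0 < cg → ∀ γs : ℝ, 0 < γs → ∃ p₀ : ℕ,
    Tendsto (fun N : ℕ => localGibbsLaw σ a₀ u₀ θ₀ N (Φ N)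
      {z | ¬ ∀ (x : T3) (ϱ : ℝ), hN N ≤ ϱ → ϱ ≤ 8 * hN N →
        cg * (((N : ℝ) + 1) * ϱ ^ 3 * nu σ N * t) ≤ cnt (Φ N) z t x ϱ →
        (∀ p : ℕ, 2 ≤ p → p ≤ idx r N →
          gainOne (Φ N) z t x ϱ p ≤
            (if p₀ ≤ p then γs else 1) / 2 * mixed (Φ N) z t x ϱ p + γ₂ * cmom (Φ N) z t x ϱ p) ∧
        (∀ k l : ℕ, 1 ≤ k → 1 ≤ l → k + l ≤ idx r N →
          cross (Φ N) z t x ϱ k l * cnt (Φ N) z t x ϱ ≤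
            K * (cmom (Φ N) z t x ϱ k * cmom (Φ N) z t x ϱ l))})
      atTop (𝓝 0)

/-- **Short flights (H1 / (R), tilted, windowed, with a thermal budget) — where STIFFNESS enters.**
`∃ r > 0, C_R, B`: with probability `→ 1`, for EVERY window `B(x,ϱ)` with `ϱ ≥ h_N` (the whole torus
included) and every level `p ≤ ⌊r log(N+2)⌋ + 1`:
`∫₀ᵗ Σ_{i ∈ B(x,ϱ)} |vᵢ|^{2p}(1+|vᵢ|) ds ≤ (C_R/ν_N)·[Σ_{i ∈ B(x,ϱ+h_N) at time 0} |vᵢ(0)|^{2p}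
+ Σ_{records in B(x,ϱ+h_N)} |v_fst⁺|^{2p}] + B^p p!·(N+1)ϱ³ t` — the `|v|^{2p}(1+|v|)`-occupation of
a window is the Enskog flight time `≍ 1/(ν_N(1+|v|))` times the `|v|^{2p}`-SUPPLY of flights started
inside the `h_N`-fattened window (at time `0`, or as the outgoing first particle of a record), up to an
additive THERMAL budget of the size of a Maxwellian occupation (which absorbs any sub-extensive
channelled population: a capped sphere weighs `≤ N^{aC²}` against `(N+1)ϱ³ ≥ N^{1/2}`). Flights longer
than `h_N ≫` mean free path must be negligible in the tilted sum: NO CHANNELLING, in weighted mean,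
window by window — never sphere by sphere. -/
def ShortFlightsAt (σ : ℝ) (a₀ θ₀ : T3 → ℝ) (u₀ : T3 → V3) (Φ : Flows σ) (t : ℝ) : Prop :=
  ∃ r CR B : ℝ, 0 < r ∧
    Tendsto (fun N : ℕ => localGibbsLaw σ a₀ u₀ θ₀ N (Φ N)
      {z | ¬ ∀ (x : T3) (ϱ : ℝ), hN N ≤ ϱ → ∀ p : ℕ, p ≤ idx r N + 1 →
        occ (Φ N) z t x ϱ p ≤
          CR / nu σ N * (supplyInit z x (ϱ + hN N) p + gainOne (Φ N) z t x (ϱ + hN N) p) +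
            B ^ p * (p.factorial : ℝ) * (((N : ℝ) + 1) * ϱ ^ 3 * t)})
      atTop (𝓝 0)

/-- **Window envelope in COLLISION currency (the C3 input; carries the hot-spot / vacuum exposure).**
`∃ c_f, C_f, Θ_c > 0`: with probability `→ 1`, EVERY window `B(x,ϱ)`, `h_N ≤ ϱ ≤ 8h_N`, has an
Enskog-order number of records, `c_f ≤ c₀ / ((N+1)ϱ³ν_N t) ≤ C_f` (no collisionally dead and no
collisionally jammed window: density floor/ceiling and temperature floor behind it — (ii)'s shadow),
and a bounded ORDER-ONE collision temperature, `c₁ ≤ Θ_c c₀` (mean incoming energy per record; the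
base of the polynomial induction and the only place a temperature envelope enters — at order one,
not at exponential order, so nothing of (i) is assumed). -/
def WindowEnvelopeAt (σ : ℝ) (a₀ θ₀ : T3 → ℝ) (u₀ : T3 → V3) (Φ : Flows σ) (t : ℝ) : Prop :=
  ∃ cf Cf Θc : ℝ, 0 < cf ∧ 0 < Θc ∧
    Tendsto (fun N : ℕ => localGibbsLaw σ a₀ u₀ θ₀ N (Φ N)
      {z | ¬ ∀ (x : T3) (ϱ : ℝ), hN N ≤ ϱ → ϱ ≤ 8 * hN N →
        cf * (((N : ℝ) + 1) * ϱ ^ 3 * nu σ N * t) ≤ cnt (Φ N) z t x ϱ ∧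
        cnt (Φ N) z t x ϱ ≤ Cf * (((N : ℝ) + 1) * ϱ ^ 3 * nu σ N * t) ∧
        cmom (Φ N) z t x ϱ 1 ≤ Θc * cnt (Φ N) z t x ϱ})
      atTop (𝓝 0)

/-- Component **(i)** of the crux at `(σ, profiles, Φ, t)` — VERBATIM the first conjunct of
`AprioriBounds` after its `∀ t, 0 < t →`. -/
def PartIAt (σ : ℝ) (a₀ θ₀ : T3 → ℝ) (u₀ : T3 → V3) (Φ : Flows σ) (t : ℝ) : Prop :=
  ∃ lam Cexp : ℝ, 0 < lam ∧ Tendsto (fun N : ℕ => localGibbsLaw σ a₀ u₀ θ₀ N (Φ N)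
    {z | Cexp < ∫ s in Icc 0 t, ∫ y, Real.exp (lam * ‖y.2‖ ^ 2)
      ∂(empiricalMeasure ((Φ N).flow s z))}) atTop (𝓝 0)

/-! ## Proved glue: the per-record Povzner split and the mixed moment -/

/-- **The exact Povzner split, per collision.** If `g = h·E^p` is the total outgoing level-`p` weight
of a collision with incoming energies `E₁, E₂` (`E = E₁ + E₂`, `h = h_p(u)`), then
`g − E₁^p − E₂^p = h·[(E₁+E₂)^p − E₁^p − E₂^p] − (1 − h)(E₁^p + E₂^p)`: the gain lives on the MIXED
moment with coefficient `h`, the loss on the own moments with coefficient `1 − h`. [folklore;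
BobylevGambaPanferov2004 Lemma 1 read per collision] -/
theorem povzner_split (E₁ E₂ h : ℝ) (p : ℕ) :
    h * (E₁ + E₂) ^ p - E₁ ^ p - E₂ ^ p =
      h * ((E₁ + E₂) ^ p - E₁ ^ p - E₂ ^ p) - (1 - h) * (E₁ ^ p + E₂ ^ p) := by
  ring

/-- The mixed binomial moment of one collision is nonnegative: `E₁^p + E₂^p ≤ (E₁+E₂)^p` for
`E₁, E₂ ≥ 0`, `p ≥ 1`. [folklore] -/
theorem mixed_term_nonneg {E₁ E₂ : ℝ} (h₁ : 0 ≤ E₁) (h₂ : 0 ≤ E₂) {p : ℕ} (hp : p ≠ 0) :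
    0 ≤ (E₁ + E₂) ^ p - E₁ ^ p - E₂ ^ p := by
  have := pow_add_pow_le h₁ h₂ hp
  linarith

/-- Energy is conserved record by record (so the outgoing energy fraction `u = |v_fst⁺|²/E` of a
record is well defined with `E` read off either side): for a record read off a configuration,
`|v_fst⁻|² + |v_snd⁻|² = |v_fst⁺|² + |v_snd⁺|²`. [folklore] -/
theorem record_energy {N : ℕ} (ε : ℝ) (w : Cfg N) (τ : ℝ) (i j : Fin (N + 1)) :
    ‖(HardSphereCollisionRecord.ofConfig (Torus.geometry (Fin 3)) ε w τ i j).preVel.1‖ ^ 2 +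
        ‖(HardSphereCollisionRecord.ofConfig (Torus.geometry (Fin 3)) ε w τ i j).preVel.2‖ ^ 2 =
      ‖(HardSphereCollisionRecord.ofConfig (Torus.geometry (Fin 3)) ε w τ i j).postVel.1‖ ^ 2 +
        ‖(HardSphereCollisionRecord.ofConfig (Torus.geometry (Fin 3)) ε w τ i j).postVel.2‖ ^ 2 :=
  HardSphereCollisionRecord.ofConfig_norm_sq_preVel _ _ _ _ _ _

/-! ## Registered stubs (`Holds.stub_*`, bodies `sorry`) -/

namespace Holds

/-- STUB 1 — INITIAL WINDOW CONTENT (t = 0; size M–L; provable now). For nice profiles,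
`0 < σ ≤ 1/2` and every flow family: `InitWinAt` — there is `a₁ > 0` (any `a₁ < 1/(8 sup θ₀)`;
`sup θ₀ < ∞` by compactness of `𝕋³`) such that for every `0 < a ≤ a₁` some deterministic `C₀` bounds
the Gaussian content `(N+1)⁻¹Σ_{i ∈ B(x,ϱ)} e^{a|vᵢ(0)|²} ≤ C₀ϱ³` of EVERY window `ϱ ≥ h_N` (the
whole torus, `ϱ = 1 > diam 𝕋³`, included) w.h.p. Proof sketch: `localGibbsLaw_eq` (the law does not
depend on `Φ`) + `lintegral_localGibbsMeasure` (given the positions the velocities are independent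
Gaussians `N(u₀(xᵢ), θ₀(xᵢ))`); a window holds at most `C σ⁻³ (N+1) ϱ³` spheres (hard-core packing,
deterministic) and nothing is needed from below; reduce the continuum of windows to a finite
`h_N`-net (`B(x,ϱ) ⊆ B(x_j, ϱ + h_N)`, `≍ N^{1/2}` net points, radii on a geometric grid up to `1`);
per net window a FOURTH-moment Chebyshev bound for the sum of the independent `e^{a|vᵢ|²}` (finite
fourth moment iff `8a sup θ₀ < 1`, `Literature.Barriers.AtomisticToContinuum.lintegral_exp_quadratic_lt_top`)
gives failure probability `≤ C/((N+1)ϱ³)² ≤ C N^{-1}`, summable over the `N^{1/2}·O(log N)` net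
windows.
Why it might fail: it cannot (static Gaussian LLN; the same B1 content as `visit-ledger`'s
`stub_initialMoment`, windowed). Sources: Spohn1991 Part I Ch. 3 (local Gibbs states);
`HardSphereEulerProofs` (`lintegral_localGibbsMeasure`, `isProbabilityMeasure_localGibbsLaw`). -/
theorem stub_initialWindows :
    ∀ (a₀ θ₀ : T3 → ℝ) (u₀ : T3 → V3), NiceProfiles a₀ θ₀ u₀ →
      ∀ σ : ℝ, 0 < σ → σ ≤ 1 / 2 → ∀ Φ : Flows σ, InitWinAt σ a₀ θ₀ u₀ Φ := by
  sorry

/-- STUB 2 — THE SPEED CAP (E4) = `SpeedCapSurgery.MaxSpeedBoundLog` VERBATIM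
(stmt-AtomisticToContinuum-9629, crux rank 2 of route `SpeedCapSurgery`, open; size XL as
mathematics; the identity of the two statements is certified by `stub_speedCap_iff_maxSpeedBoundLog :
_ ↔ _ := Iff.rfl`, so a proof of either discharges this stub). For nice profiles
`∃ σ₀ ∀ σ ∈ (0,σ₀) ∀ t ≥ 0 ∀ Φ ∃ C`: the probability that some sphere is faster than `C√log(N+2)` at
some time in `[0,t]` tends to `0`. Role HERE (triage r1-1 sharpen 1 / r1-3 sharpen: "bulk Povzner
engine + cap for the empty top"): on the cap event every incoming energy is `≤ C² log(N+2)`, so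
(a) the exponential collision moments `Σ_records e^{a|v⁻|²} = Σ_p a^p c_p/p!` are their Taylor
polynomials of degree `⌊r log(N+2)⌋` up to a relative error `e^{-⌊r log(N+2)⌋}` once `a ≤ r/(e²C²)`
("a small is free"), and likewise the crux functional — so the Povzner statistics are needed only
on the POPULATED range, where they are law-of-large-numbers statements; (b) nothing is ever asked
of an empty energy shell. Intended producer on this crux's board: `pythagorean-mgf-transport`
(`EnvelopeGivesCap`, horizon-indexed mgf fixed point; cap constant `C² = (8/3+δ)Θ`). Why it might
fail: it is the beyond-entropy a priori estimate nobody has (OVY1993 §1, NachtergaeleYau2003 II.1);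
`∀ t` exposure — past a Guderley collapse the core heats without bound (Disproof §5) and no `C` need
exist; a pre-shock focusing cascade reaching `N^{ε}` speeds would refute it and this line with it.
Sources: OllaVaradhanYau1993 (doi:10.1007/bf02096727), NachtergaeleYau2003, route SpeedCapSurgery,
Disproof §4d/§5. -/
theorem stub_speedCap :
    ∀ (a₀ θ₀ : T3 → ℝ) (u₀ : T3 → V3), Continuous a₀ → Continuous θ₀ → Continuous u₀ →
      (∀ x, 0 < a₀ x) → (∀ x, 0 < θ₀ x) →
      ∃ σ₀ : ℝ, 0 < σ₀ ∧ ∀ σ : ℝ, 0 < σ → σ < σ₀ → ∀ t : ℝ, 0 ≤ t → ∀ Φ : Flows σ,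
        ∃ C : ℝ, Tendsto (fun N : ℕ => localGibbsLaw σ a₀ u₀ θ₀ N (Φ N)
          {z | ∃ r ∈ Icc 0 t, ∃ i, C * Real.sqrt (Real.log ((N : ℝ) + 2)) < ‖((Φ N).flow r z i).2‖})
          atTop (𝓝 0) := by
  sorry

/-- STUB 3 — POVZNER STATISTICS OF THE WINDOWS (OPEN; the chaos input of the line; size L as a
statement). For nice profiles `∃ σ₀ ∀ σ ∈ (0,σ₀) ∀ Φ ∀ t > 0`: `PovznerStatsAt` — H2 (impact spread,
THRESHOLD form: own-weighted mean of `h_p` at most `γ₂ < 1` for `2 ≤ p`, mixed-weighted mean at most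
any prescribed `γ⋆` from some `p₀(γ⋆)` on) and H3 (in-window partner domination
`c_{k,l} c₀ ≤ K c_k c_l`, `k,l ≥ 1`), for ALL windows of scale `h_N … 8h_N` holding at least
`c_g (N+1)ϱ³ν_N t` records (ANY threshold `c_g > 0`; `p₀` may depend on it; the engine takes
`c_g := c_f`) and all indices in the populated range `≤ ⌊r log(N+2)⌋`, w.h.p. Why plausible: (H2) for a fast sphere on thermal scatterers
the outgoing energy fraction has a bounded density on `[0,1]` (impact parameter uniform in the disc
⇒ `c_v ~ U[0,1]`, triage r1-1 §F; BobylevGambaPanferov2004: `γ_p = 2/(p+1)` for hard spheres), so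
`E h_p → 0` and `E h_p < 1` strictly unless impacts pile up at `u ∈ {0,1}`; (H3) at equilibrium the
law of incoming pairs factorises exactly in structure (Gibbs factorises velocities from positions;
incoming = half-space), within-window temperature mixing costs a factor `→ 1` on levels `≤ r log N`
because `h_N log N → 0` (IdeatorTwoBarrierNotes B5: the GLOBAL pairing is off by `p^{3/2}` at a
temperature maximum — `SpeedCapSurgery.ContactIntensityDomination`, stmt-4604, NOT used), and the
Chebyshev sum inequality `c_k c_l/c₀ ≳` (flux-tilted products) absorbs the flux weight (`K ≈ 4`).
Both are stated only where `≳ N^{5/6-r}e^{O(1)}` records carry the weight (LLN regime; triage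
granularity test passed by construction: no "all levels, one constant" clause — the top is the cap's).
Why it might fail: TAIL CLUSTERING at fixed `σ` along the non-equilibrium law — recollision loops /
transient dense clusters keeping energetic incoming pairs positively dependent beyond a constant
(kills H3; common-mode with `pythagorean`'s K1, `visit-ledger`'s (U♭), `energy-pedigree`'s R2: one kit
MD job tests all — card falsifier (c): per-window partner-energy copula ratio and `(p+1)·⟨h_p⟩`,
predicted `K ≤ 2`, N-independent); GRAZING-dominated statistics of energetic collisions (a fast sphere
skimming a wake; the closed board item 4605 `EnergySplitEquidistribution` named this) pushing the
mixed-weighted `h_p` to `1` (kills H2's `γ⋆`, leaving only order-1 exponential moments); hot filaments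
thinner than `h_N`. No Enskog-type derivation exists at fixed `σ` out of equilibrium. Sources:
BobylevGambaPanferov2004 (doi:10.1023/b:joss.0000041751.11664.ea, Lemma 1 / Thm 1),
GambaPanferovVillani2009 (arXiv:math/0701081, Thm 3, Lemma 12), AlonsoCanizoGambaMouhot2013
(arXiv:1203.2364, Lemma 3 p. 5: only a THRESHOLD on `γ_p` is used), CIP1994 §2 / §6.2 Lemma 6.2.1,
MischlerMouhot2013 (arXiv:1107.3251: the stochastic rung where H2–H3 hold by construction),
triage r1-1 §C(2), r1-3 C2. -/
theorem stub_povznerStatistics :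
    ∀ (a₀ θ₀ : T3 → ℝ) (u₀ : T3 → V3), NiceProfiles a₀ θ₀ u₀ →
      ∃ σ₀ : ℝ, 0 < σ₀ ∧ ∀ σ : ℝ, 0 < σ → σ < σ₀ → ∀ Φ : Flows σ, ∀ t : ℝ, 0 < t →
        PovznerStatsAt σ a₀ θ₀ u₀ Φ t := by
  sorry

/-- STUB 4 — SHORT FLIGHTS, TILTED, WINDOWED (OPEN; the no-channelling input of the line and the
place where the stiffness `ν_N = σ²(N+1)^{1/3} → ∞` is cashed; size L). For nice profiles
`∃ σ₀ ∀ σ ∈ (0,σ₀) ∀ Φ ∀ t > 0`: `ShortFlightsAt` — w.h.p., for every window `B(x,ϱ)`, `ϱ ≥ h_N` (the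
whole torus included), and every level `p ≤ ⌊r log(N+2)⌋ + 1`, the `|v|^{2p}(1+|v|)`-occupation is
at most `C_R/ν_N` times the `|v|^{2p}`-supply of flights started in the `h_N`-fattened window (time-0
spheres + outgoing first particles of records) plus a thermal budget `B^p p! (N+1)ϱ³t`. TWO ROLES in
the engine: (a) with `ϱ ≍ h_N` it converts the transport LEAK of a window (weight
`|∇χ| |v| ψ_p ≤ h_N⁻¹ 𝟙_{2h-ball} |v|^{2p+1}`) into `(h_N ν_N)⁻¹ ×` collision moments of the neighbouring
windows — a perturbation of the loss of relative size `C_R C_f/(c_f h_N ν_N) ≍ N^{-1/6} → 0`,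
uniformly in `p` (triage r1-1 §C(3)); (b) with `ϱ ≥ 1` (global) it converts the engine's output —
bounded exponential COLLISION moments — into the crux's bounded time-averaged OCCUPATION moment.
Why plausible: the Enskog free path of a sphere among thermal scatterers is speed-independent,
`≈ (N+1)^{-1/3}/(√2πσ²ρ̄) ≪ h_N`, so flights leaving a fattened window are exponentially rare
(`e^{-h_N ν_N/…}`) and the flight TIME is `≍ 1/(ν_N(1+|v|))` (vBLLS1980 Lorentz picture; BGSR2016
tagged sphere); at equilibrium the statement in expectation is Palm calculus under the invariant law,
and the budget term makes the event robust (any population of `≪ N^{1/2-aC²}` capped channelled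
spheres per window is free). Kit evidence on the sibling card (`visit-ledger`, j009532/j009539):
`ν⟨soj⟩` by energy bin noneq `≤` eq, identical at N = 2000/4000 to three digits. Why it might fail:
CHANNELLING — a sub-extensive but `|v|^{2p}`-heavy population (`≳ N^{1/2}` spheres through ONE
mesoscopic window) of fast spheres co-moving with a cold dense stream or shielded inside an ordered
cluster, with flights `≫ h_N`; the `O(N)` entropy budget cannot exclude `e^{-o(N)}`-cheap structures
(IdeatorTwoBarrierNotes B2 — the universal sub-extensive input of every (i)-line, triage r1-2 G2(β));
near-vacuum windows (no scatterers: (ii)'s floor is silently behind `C_R`); the crux's `∀ t` exposure.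
Differs from the dead step of retired 4603 `FastParticleCollisionRate` (LOSS form, every
sub-interval, in expectation, all `p`: false for channelled SURVIVORS): whole window `(0,t]`, initial
supply pays for survivors, populated range, additive budget. Sources:
vanBeijerenLanfordLebowitzSpohn1980 (JSP 22), BodineauGallagherSaintRaymond2016 (arXiv:1305.3397),
Spohn1991 Part I Ch. 8, BuragoFerlegerKononenko1998 (doi:10.2307/120962, uniform local collision
bounds; acq-02983), triage r1-1 §C(3). -/
theorem stub_shortFlights :
    ∀ (a₀ θ₀ : T3 → ℝ) (u₀ : T3 → V3), NiceProfiles a₀ θ₀ u₀ →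
      ∃ σ₀ : ℝ, 0 < σ₀ ∧ ∀ σ : ℝ, 0 < σ → σ < σ₀ → ∀ Φ : Flows σ, ∀ t : ℝ, 0 < t →
        ShortFlightsAt σ a₀ θ₀ u₀ Φ t := by
  sorry

/-- STUB 5 — THE WINDOW ENVELOPE IN COLLISION CURRENCY (OPEN; the C3 input every (i)-line carries,
here at ORDER ONE; size L; carries the hot-spot exposure). For nice profiles
`∃ σ₀ ∀ σ ∈ (0,σ₀) ∀ Φ ∀ t > 0`: `WindowEnvelopeAt` — w.h.p. every window `h_N ≤ ϱ ≤ 8h_N` has an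
Enskog-order record count from both sides, `c_f ≤ c₀/((N+1)ϱ³ν_N t) ≤ C_f`, and mean incoming energy
per record `≤ Θ_c`. Roles: the two-sided counts make windows COMPARABLE (normalised moments of a
`5h`-ball are `≤ (C_f/c_f)·O(1) ×` the max over `h`-balls covering it; the leak coefficient and the
initial-data term `(N+1)m_p^W(0)/c₀ ≤ p! a₁^{-p} C₀/(c_f ν_N t) → 0` are normalised by `c_f`), and
`Θ_c` is the base case `ĉ₁ ≤ Θ_c` of the polynomial induction. Why plausible: Enskog collision
frequency `≍ ν_N ρ̄ √θ̄ g₂(σ)` per sphere — bounded above and below as long as block density and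
temperature stay in a compact chamber (pre-shock: the classical solution's `ρ, θ` are bounded above
and below on `[0,t] × 𝕋³`; at equilibrium an LLN over `≍ N^{5/6}` records per window); `Θ_c ≈`
flux-weighted mean energy `≈ 2 sup θ`. Why it might fail: exactly the crux's exposure — a Guderley
collapse (Disproof §5: vacuum ⇒ `c_f` fails, unbounded temperature ⇒ `Θ_c` fails; `PersistentHotSpot`
is its LLN form), a pre-collapse implosion through `ρ̄σ³ = 1` (MRRS2022 / BCG arXiv:2208.09445
Thm 1.1; jamming ⇒ contact value and `C_f` blow up); cold pockets (`θ → 0` ⇒ `c_f` fails) — none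
occurs before the first singularity of a classical hs-Euler solution with positive data. This is
where the line "uses H": the Disproof's message (c) (λ dictated by the hottest block) enters through
`Θ_c` and only at order one. Sources: Disproof §5–§7, Résibois–De Leener 1977 (Enskog frequency),
Spohn1991 Part I Ch. 3/8, triage r1-2 G3 / r1-3 C3 (one stopping time with the (ii)-line's window:
`commutator-matched-bootstrap` supplies the chamber and temperature caps pre-shock). -/
theorem stub_windowEnvelope :
    ∀ (a₀ θ₀ : T3 → ℝ) (u₀ : T3 → V3), NiceProfiles a₀ θ₀ u₀ →
      ∃ σ₀ : ℝ, 0 < σ₀ ∧ ∀ σ : ℝ, 0 < σ → σ < σ₀ → ∀ Φ : Flows σ, ∀ t : ℝ, 0 < t →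
        WindowEnvelopeAt σ a₀ θ₀ u₀ Φ t := by
  sorry

/-- STUB 6 — THE LEVER: LOCALISED POVZNER / WINDOWED ACGM BARRIER ARGUMENT (deterministic given the
five events; size XL; LOAD-BEARING). For nice profiles, `0 < σ ≤ 1/2` (probability laws), every `Φ`
and `t > 0`: `InitWinAt → CapAt → PovznerStatsAt → ShortFlightsAt → WindowEnvelopeAt → PartIAt`, with
the rate `λ := a⋆ := min{a₁, r/(2e²C²), r'/(2e²C²), 1/(2B), a₂}` (`a₂ = a₂(p₀, M_1..M_{p₀})` below) and
an explicit `Cexp(t, C₀, C_R, B, C_f, c_f, Θ_c, K, γ₂)`. PROOF SKETCH (everything on the intersection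
`G_N` of the five good events and `Φ.good`; `P_N(G_Nᶜ) → 0` by a union bound, outer-measure
monotonicity, `localGibbsLaw(goodᶜ) = 0` via `localGibbsLaw_eq` + absolute continuity +
`HardSphereFlow.measure_compl_good`).
(1) LOCALISED TELESCOPING with the ramp window `χ_{x} = h⁻¹∫_h^{2h} 𝟙_{B(x,ρ)}dρ` (Lipschitz,
`|d/ds χ(xᵢ(s))| ≤ |vᵢ|/h` along free flight, `h = h_N`): for `ψ_p = |·|^{2p}`,
`c_p^χ − g_p^χ = [Σᵢχ(xᵢ)ψ_p(vᵢ)]₀^t-reversed + leak ≤ (N+1)m_p^χ(0) + h⁻¹·occ(x,2h,p)`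
(`IdeatorTwo.VelocityTelescoping`: piecewise free flight, jumps at the locally finite record times,
`IsHardSphereTrajectory`, `leftLim_eq_collidePair`; the final-time term is dropped, `ψ_p ≥ 0`).
(2) POVZNER per window: H2 integrated over the radii (linear in the window weight) gives
`g_p^χ ≤ (γ/2)M_p^χ + γ₂c_p^χ`; H3 + `povzner_split`/binomial expansion give
`M_p^χ ≤ K' Σ_{k=1}^{p-1} (p choose k) ĉ_k ĉ_{p-k} · c₀`, normalised moments `ĉ` taken as the MAX over
all `h`-ramp windows, the comparability constants of `stub_windowEnvelope` and a covering of `5h`-balls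
by `≤ 11³` `h`-balls of `𝕋³` folded into `K'`; the leak is `≤ δ_N ×` (level-`p` supply of the
`3h`-window) with `δ_N = C_R/(h_N ν_N) → 0` plus the budget `B^p p!(N+1)(2h)³t/h`, and the supply's
`g_p` is again bounded by H2/H3. Net, with `X_p := max_windows ĉ_p`:
`(1 − γ₂ − O(δ_N)) X_p ≤ o(1)·p! a₁^{-p} + (γ/2)K' Σ_{k=1}^{p-1} (p choose k) X_k X_{p-k} + O(B^p p!/(h ν))`.
(3) POLYNOMIAL INDUCTION for `p < p₀` (no smallness needed, `γ = 1`): `X_1 ≤ Θ_c` (envelope), hence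
`X_p ≤ M_p(Θ_c, K', γ₂, p)` for `p < p₀`, N-uniformly.
(4) EXPONENTIAL LEVEL on `[p₀, P]`, `P = ⌊r log(N+2)⌋`: multiply by `a^p/p!` and sum; the gain double
sum is `≤ (γ⋆K'/2)·F(a)²` with `F(a) := max_windows Σ_{p ≤ P} a^p ĉ_p/p!`; CONTINUITY IN THE RATE:
`F(0) = 1`, `F` is a max of polynomials with bounded nonnegative coefficients (Lipschitz on `[0,a⋆]`);
on `{F ≤ 4}` one gets `F ≤ 1 + Σ_{p<p₀} a^p M_p/p! + [o(1) + 8γ⋆K' + 2Σ(aB)^p·o(1)]/(1−γ₂−o(1)) < 3`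
for `a ≤ a₂` and `γ⋆ := (1−γ₂)/(64K')` (this, with the population guard `c_g := c_f` discharged by
`stub_windowEnvelope`, fixes `p₀` through `stub_povznerStatistics`' `∀ c_g ∀ γ⋆ ∃ p₀`), so
`F(a⋆) ≤ 4` for all large `N`: EVERY window has per-record exponential moment `≤ 4` — the
RELATIVE no-concentration input H4_rel of triage r1-2 §C is thereby a CONSEQUENCE (of the order-one
envelope and in-window domination), never a hypothesis at exponential level.
(5) TAYLOR TAILS by the cap: incoming energies `≤ C² log(N+2)` on the cap event, so degrees `> P`
contribute a relative `e^{-P} → 0` once `a⋆ ≤ r/(2e²C²)` (`Σ_{p>P} x^p/p! ≤ (ex/P)^P`).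
(6) OUTPUT: tiling `[0,t]` by flights, `∫₀ᵗ (N+1)⁻¹Σᵢ e^{a⋆|vᵢ|²} ds ≤ (N+1)⁻¹ Σ_p (a⋆^p/p!) occ(𝕋³,p)
≤ (N+1)⁻¹ Σ_p (a⋆^p/p!)[(C_R/ν_N)(supplyInit + g_p(𝕋³)) + B^p p!(N+1)t] ≤ C_R(C₀'/ν_N + 4C_f t·O(1)) + 2t`
(`stub_shortFlights` at `ϱ ≥ 1`, the global window as a union of `O(h^{-3})` mesoscopic ones with
counts `≤ C_f(N+1)h³ν_N t` each; degrees `> P+1` by the cap again) `=: Cexp − 1`, a DETERMINISTIC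
constant — exactly the typed "`∃ C`, probability `→ 0`" form. (The Bochner integral over `Icc 0 t` of
the finite empirical average equals the pathwise flight sum on `Φ.good`: bounded measurable
integrand, `IsHardSphereTrajectory.measurable_torus`, `integral_empiricalMeasure`.)
Why it might fail: it is a theorem given its hypotheses; the risks are bookkeeping ones, flagged for
the lead — (a) the comparability/covering constants enter `K'` and hence `γ⋆` and `p₀`, but NOT the
order (rate, not order: triage r1-1 §C(1), r1-2 §C); (b) the two records of a collision may fall in
different windows (partners `ε_N ≪ h_N` apart) — absorbed because H2/H3 are stated per record with
first-particle weights; (c) continuity is in the RATE `a`, not in the horizon, so no single-collision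
jump control is needed (triage r1-1 sharpen 3 answered). Sources: AlonsoCanizoGambaMouhot2013
(arXiv:1203.2364, Thm 2 p. 4, Lemma 3 p. 5, Lemma 10 p. 7, proof p. 9 — page-read by triage r1-3),
BobylevGambaPanferov2004, GambaPanferovVillani2009 (arXiv:math/0701081 Thm 2(iv), Thm 3),
Bobylev1997, MischlerWennberg1999; the retired board item 4606 `AbstractPovznerGaussian` is the
abstract global template this windowed, time-integrated, rate-continuity version replaces
(triage r1-1 sharpen 3: not reusable verbatim). -/
theorem stub_localisedPovzner :
    ∀ (a₀ θ₀ : T3 → ℝ) (u₀ : T3 → V3), NiceProfiles a₀ θ₀ u₀ →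
      ∀ σ : ℝ, 0 < σ → σ ≤ 1 / 2 → ∀ Φ : Flows σ, ∀ t : ℝ, 0 < t →
        InitWinAt σ a₀ θ₀ u₀ Φ → CapAt σ a₀ θ₀ u₀ Φ t → PovznerStatsAt σ a₀ θ₀ u₀ Φ t →
          ShortFlightsAt σ a₀ θ₀ u₀ Φ t → WindowEnvelopeAt σ a₀ θ₀ u₀ Φ t →
            PartIAt σ a₀ θ₀ u₀ Φ t := by
  sorry

/-- STUB 7 — THE CHAMBER, component (ii), DOCKED (size XL; not this idea's lever). For nice profiles
`∃ σ₀ ∀ σ ∈ (0,σ₀)`: `AprioriBoundsNegative.AprioriBoundsIIAt σ a₀ θ₀ u₀` — conjunct (ii) of the crux at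
`σ`, verbatim, as LANDED in `Theorems/AprioriBounds/Negative/WithoutSmallSigma.lean` (so the
disprover's tightness lemmas bear on this stub by name: `aprioriBoundsIIAt_false` at every
`1 < σ³ < √2`, `aprioriBounds_sigma0_le_one`, `badEventII_eq_univ_of_one_lt_c1` — honoured: `σ₀` and
`c₁` stay existential, forced `≤ 1`; `stub_chamber_of_aprioriBounds` below proves it is EXACTLY the
(ii)-projection of the crux, no strengthening). Producers on this crux's board: the sibling lines
`commutator-matched-bootstrap` ≈ `bootstrap-chamber-confinement` (hard-core packing makes `ρ̄`
Lipschitz at the kernel scale; one bad cell = an `L²`-defect `≍ N^{-3γ}` against the classical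
solution; matched-commutator relative entropy on a stopped window; triage pass ×3), which deliver (ii)
PRE-SHOCK inside the dilute chamber (triage r1-3 C1) — and whose stopped window is what makes
`stub_windowEnvelope`'s `c_f, C_f, Θ_c` and `stub_speedCap`'s `C` finite (one stopping time, r1-2 G3).
Why it might fail: focusing — a pre-collapse implosion passing `ρ̄σ³ = 1` at small `σ`
(MRRS2022 / BuckmasterCaoLaboraGomezSerrano arXiv:2208.09445 Thm 1.1, on `𝕋³` via arXiv:2310.05325;
undecided even at PDE level whether the hard-sphere excess pressure arrests it), post-collapse vacuum
(Disproof §5), the exposure of `DiluteSelfConsistency` (stmt-3091). Sources: Disproof §2–§3, §5–§6;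
Sideris1985; Spohn1991. -/
theorem stub_chamber :
    ∀ (a₀ θ₀ : T3 → ℝ) (u₀ : T3 → V3), NiceProfiles a₀ θ₀ u₀ →
      ∃ σ₀ : ℝ, 0 < σ₀ ∧ ∀ σ : ℝ, 0 < σ → σ < σ₀ →
        Summit.AtomisticToContinuum.HydrodynamicLimit.Theorems.AprioriBoundsNegative.AprioriBoundsIIAt
          σ a₀ θ₀ u₀ := by
  sorry

end Holds

/-! ## Stub statements by name (D-0027 §3.3: the hypotheses of `_of` are these `Prop`s) -/

/-- Statement of registered stub 1 (`Holds.stub_initialWindows`), by name. -/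
def stub_initialWindows : Prop := type_of% Holds.stub_initialWindows
/-- Statement of registered stub 2 (`Holds.stub_speedCap`), by name (= `MaxSpeedBoundLog`). -/
def stub_speedCap : Prop := type_of% Holds.stub_speedCap
/-- Statement of registered stub 3 (`Holds.stub_povznerStatistics`), by name. -/
def stub_povznerStatistics : Prop := type_of% Holds.stub_povznerStatistics
/-- Statement of registered stub 4 (`Holds.stub_shortFlights`), by name. -/
def stub_shortFlights : Prop := type_of% Holds.stub_shortFlights
/-- Statement of registered stub 5 (`Holds.stub_windowEnvelope`), by name. -/
def stub_windowEnvelope : Prop := type_of% Holds.stub_windowEnvelope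
/-- Statement of registered stub 6 (`Holds.stub_localisedPovzner`), by name. -/
def stub_localisedPovzner : Prop := type_of% Holds.stub_localisedPovzner
/-- Statement of registered stub 7 (`Holds.stub_chamber`), by name. -/
def stub_chamber : Prop := type_of% Holds.stub_chamber

/-- DOCKING CERTIFICATE for stub 2: its statement IS the route-external item
`SpeedCapSurgery.MaxSpeedBoundLog` (stmt-AtomisticToContinuum-9629), definitionally. -/
theorem stub_speedCap_iff_maxSpeedBoundLog :
    stub_speedCap ↔
      Summit.AtomisticToContinuum.HydrodynamicLimit.Theses.SpeedCapSurgery.MaxSpeedBoundLog :=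
  Iff.rfl

/-- DOCKING CERTIFICATE for stub 7: it is exactly the (ii)-projection of the crux (so it is not a
strengthening of anything the crux claims; `aprioriBoundsIIAt_of_aprioriBounds` is the disprover's
landed projection lemma). -/
theorem stub_chamber_of_aprioriBounds
    (h : Summit.AtomisticToContinuum.HydrodynamicLimit.Theses.CollisionIsometryCLT.AprioriBounds) :
    stub_chamber :=
  fun a₀ θ₀ u₀ hP =>
    Summit.AtomisticToContinuum.HydrodynamicLimit.Theorems.AprioriBoundsNegative.aprioriBoundsIIAt_of_aprioriBounds
      h a₀ θ₀ u₀ hP.1 hP.2.1 hP.2.2.1 hP.2.2.2.1 hP.2.2.2.2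

/-- SANITY (pure logic): the crux IS `∀ profiles ∃ σ₀ ∀ σ < σ₀ ∀ Φ ∀ t > 0, PartIAt ∧ (ii)-body` — the
engine's conclusion `PartIAt` is the crux's first conjunct verbatim. -/
theorem partIAt_of_aprioriBounds
    (h : Summit.AtomisticToContinuum.HydrodynamicLimit.Theses.CollisionIsometryCLT.AprioriBounds)
    (a₀ θ₀ : T3 → ℝ) (u₀ : T3 → V3) (hP : NiceProfiles a₀ θ₀ u₀) :
    ∃ σ₀ : ℝ, 0 < σ₀ ∧ ∀ σ : ℝ, 0 < σ → σ < σ₀ → ∀ (Φ : Flows σ) (t : ℝ), 0 < t →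
      PartIAt σ a₀ θ₀ u₀ Φ t := by
  obtain ⟨σ₀, hσ₀, H⟩ := h a₀ θ₀ u₀ hP.1 hP.2.1 hP.2.2.1 hP.2.2.2.1 hP.2.2.2.2
  exact ⟨σ₀, hσ₀, fun σ hσ hlt Φ t ht => (H σ hσ hlt Φ t ht).1⟩

/-! ## Composition (sorry-free): the seven stubs ⟹ the crux BY NAME -/

/-- **The skeleton theorem.** `σ₀ := min (min σ_cap σ_P) (min (min σ_F σ_E) (min σ_ch 2⁻¹))`. For
`σ < σ₀`, a flow family `Φ` and `t > 0`: the five events (initial windows at `σ ≤ 1/2`, the cap at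
`0 ≤ t`, Povzner statistics, short flights, window envelope) feed the engine (stub 6), whose output is
(i) at `(σ, Φ, t)` verbatim; (ii) is stub 7 verbatim. -/
theorem AprioriBounds_of
    (h1 : stub_initialWindows) (h2 : stub_speedCap) (h3 : stub_povznerStatistics)
    (h4 : stub_shortFlights) (h5 : stub_windowEnvelope) (h6 : stub_localisedPovzner)
    (h7 : stub_chamber) :
    Summit.AtomisticToContinuum.HydrodynamicLimit.Theses.CollisionIsometryCLT.AprioriBounds := by
  intro a₀ θ₀ u₀ ha hθ hu ha0 hθ0
  have hP : NiceProfiles a₀ θ₀ u₀ := ⟨ha, hθ, hu, ha0, hθ0⟩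
  have H1 := (h1 : type_of% Holds.stub_initialWindows)
  obtain ⟨σ₂, hσ₂, H2⟩ := (h2 : type_of% Holds.stub_speedCap) a₀ θ₀ u₀ ha hθ hu ha0 hθ0
  obtain ⟨σ₃, hσ₃, H3⟩ := (h3 : type_of% Holds.stub_povznerStatistics) a₀ θ₀ u₀ hP
  obtain ⟨σ₄, hσ₄, H4⟩ := (h4 : type_of% Holds.stub_shortFlights) a₀ θ₀ u₀ hP
  obtain ⟨σ₅, hσ₅, H5⟩ := (h5 : type_of% Holds.stub_windowEnvelope) a₀ θ₀ u₀ hP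
  have H6 := (h6 : type_of% Holds.stub_localisedPovzner)
  obtain ⟨σ₇, hσ₇, H7⟩ := (h7 : type_of% Holds.stub_chamber) a₀ θ₀ u₀ hP
  refine ⟨min (min σ₂ σ₃) (min (min σ₄ σ₅) (min σ₇ 2⁻¹)), ?_, ?_⟩
  · exact lt_min (lt_min hσ₂ hσ₃) (lt_min (lt_min hσ₄ hσ₅) (lt_min hσ₇ (by norm_num)))
  intro σ hσ hlt Φ t ht
  have h2lt : σ < σ₂ := lt_of_lt_of_le hlt ((min_le_left _ _).trans (min_le_left _ _))
  have h3lt : σ < σ₃ := lt_of_lt_of_le hlt ((min_le_left _ _).trans (min_le_right _ _))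
  have h4lt : σ < σ₄ :=
    lt_of_lt_of_le hlt ((min_le_right _ _).trans ((min_le_left _ _).trans (min_le_left _ _)))
  have h5lt : σ < σ₅ :=
    lt_of_lt_of_le hlt ((min_le_right _ _).trans ((min_le_left _ _).trans (min_le_right _ _)))
  have h7lt : σ < σ₇ :=
    lt_of_lt_of_le hlt ((min_le_right _ _).trans ((min_le_right _ _).trans (min_le_left _ _)))
  have hhalf : σ ≤ 1 / 2 := by
    have h := lt_of_lt_of_le hlt ((min_le_right _ _).trans ((min_le_right _ _).trans (min_le_right _ _)))
    norm_num at h ⊢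
    exact h.le
  refine ⟨?_, ?_⟩
  · -- component (i): the five events feed the windowed Povzner engine
    exact H6 a₀ θ₀ u₀ hP σ hσ hhalf Φ t ht (H1 a₀ θ₀ u₀ hP σ hσ hhalf Φ) (H2 σ hσ h2lt t ht.le Φ)
      (H3 σ hσ h3lt Φ t ht) (H4 σ hσ h4lt Φ t ht) (H5 σ hσ h5lt Φ t ht)
  · -- component (ii): the docked chamber, verbatim
    exact H7 σ hσ h7lt Φ t ht

/-- The SHARED decl: stmt-AtomisticToContinuum-9519 is ONE item wanted by both routes, and
`StiffCollisionalRelaxation.AprioriBounds` is syntactically the same `Prop`; the same seven stubs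
conclude it (by definitional unfolding of `AprioriBounds_of`'s conclusion). -/
theorem AprioriBounds_of_stiff
    (h1 : stub_initialWindows) (h2 : stub_speedCap) (h3 : stub_povznerStatistics)
    (h4 : stub_shortFlights) (h5 : stub_windowEnvelope) (h6 : stub_localisedPovzner)
    (h7 : stub_chamber) :
    Summit.AtomisticToContinuum.HydrodynamicLimit.Theses.StiffCollisionalRelaxation.AprioriBounds :=
  AprioriBounds_of h1 h2 h3 h4 h5 h6 h7

/-- D-0027 §3.3 shape, skeleton-check form: the crux (in the item's primary route file,
`StiffCollisionalRelaxation`) from the REGISTERED stubs — it becomes the proof of the item once the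
seven `sorry`s inside `Holds.stub_*` are discharged (until then it depends on `sorryAx` through them
and credits nothing). -/
theorem AprioriBounds_proof :
    Summit.AtomisticToContinuum.HydrodynamicLimit.Theses.StiffCollisionalRelaxation.AprioriBounds :=
  AprioriBounds_of_stiff Holds.stub_initialWindows Holds.stub_speedCap Holds.stub_povznerStatistics
    Holds.stub_shortFlights Holds.stub_windowEnvelope Holds.stub_localisedPovzner Holds.stub_chamber

/-- The same for the sharing route's copy of the decl (`CollisionIsometryCLT`, this line's
`route_id`). -/
theorem AprioriBounds_proof_collisionIsometryCLT :
    Summit.AtomisticToContinuum.HydrodynamicLimit.Theses.CollisionIsometryCLT.AprioriBounds :=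
  AprioriBounds_of Holds.stub_initialWindows Holds.stub_speedCap Holds.stub_povznerStatistics
    Holds.stub_shortFlights Holds.stub_windowEnvelope Holds.stub_localisedPovzner Holds.stub_chamber

end Summit.AtomisticToContinuum.HydrodynamicLimit.Cruxes.AprioriBounds.StiffLocalisedPovzner

end
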